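import Summits.Ventures.YMGap.RobustBall.BoundaryDecayBox
import Summits.Ventures.YMGap.RobustBall.MassGapOfDoorKR
import HarnessLib

/-!
# Venture YMGap, track ROBUST-BALL — ONE STATE AT A RATE, step 4: boundary insensitivity through the
# Kantorovich–Rubinstein door (any one-link modulus; the `SU(2)` quarter door, Wilson window `β_W < 2/9`)

HONEST FRAMING. WHAT THIS IS: a venture file (cell `pub-ymgap`, track Y2 ROBUST-BALL, seat ds-3, theorems only): the
carrier theorem `abs_boundary_sub_integral_le_of_isKRContraction` of `BoundaryDecay.lean` fed with ds-4's KR door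
`isKRContraction_perturbedYM_of_oneLinkKRModulus` / `sum_perturbedNbr_coeffKR_le` (`RobustMassGapDoorKR.lean`), exactly as
`MassGapOfDoorKR.lean` feeds the mass-gap currency:
* `abs_boundary_sub_integral_le_of_oneLinkKRModulus` — `d, N ≥ 1`, `OneLinkKRModulus N b K` (`K ≥ 0`, `b ≥ 2(d−1)|β|`),
  loads `(a, ℓ_s, Λ)` (oscillation, self-Lipschitz, cross-Lipschitz), range `R`,
  `6(d−1)|β| K e^{a}(1 + 2√N ℓ_s) + √N Λ ≤ ρ < 1` ⇒ for every DLR state, finite link volume, boundary field and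
  Lipschitz cylinder at depth `D`: `|∫ F dγ^W_Λ(·|η) − ∫ F dμ| ≤ 2√N · K_F · #Δ · max(ρ,½)^{⌊D/max(1,R)⌋₊}`;
* `SU(2)` QUARTER DOOR (`K = 1` on `‖B‖_op ≤ 1`), every `d` and `d = 4` (`su2_abs_boundary_sub_integral_le_quarter[_dim4]`):
  `(3/2)(d−1)|β_W| e^{a}(1 + 2√2 ℓ_s) + √2 Λ ≤ ρ < 1`;
* THE WILSON POINT THROUGH THE QUARTER DOOR, `d = 4`: for `0 ≤ β_W ≤ 1/9` every DLR state of `SU(2)` lattice Yang–Mills on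
  `ℤ⁴` vs every finite-volume Wilson distribution: `≤ 2√2 · K · #Δ · 2^{−⌊D⌋₊}` (`su2_wilson_boundary_upTo_oneNinth`), and
  for `1/9 ≤ β_W < 2/9`: `((9/2)β_W)^{⌊D⌋₊}` (`su2_wilson_boundary_lt_twoNinths`) — the quarter door's Wilson window
  `β_W < 2/9` (pair door: `1/6`); box forms `su2_wilson_box_upTo_oneNinth` / `su2_wilson_box_lt_twoNinths`; two-sided
  `|β_W| ≤ 1/9` forms `su2_wilson_boundary_abs_le_oneNinth` / `su2_wilson_box_abs_le_oneNinth`.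
WHAT THIS IS NOT: Dobrushin-comparison lower bound on the penetration rate; single-link doors; lattice strong coupling only,
nothing about the continuum limit or the Clay Millennium problem.

References: H. Föllmer, LNM 1362 (1988), Ch. I, (2.8), (2.10); H.-O. Georgii (2011), Remark 8.26; the track's
`BoundaryDecay.lean`, `RobustMassGapDoorKR.lean`, `MassGapOfDoorKR.lean`.
-/

noncomputable section

open MeasureTheory Filter Function ProbabilityTheory Real
open scoped NNReal
open Literature.Probability.LatticeModels
open Literature.Probability.LatticeModels.DobrushinMetric
open Literature.MathematicalPhysics.QuantumLattice
open Literature.MathematicalPhysics.QuantumFieldTheory hiding ZdEdge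
open Literature.MathematicalPhysics.QuantumFieldTheory.Balaban1983to89.StrongCouplingDobrushinWindow (OneLinkKRModulus)

namespace Summit.Ventures.YMGap.RobustBall

variable {d N : ℕ}

/-! ### Any one-link Kantorovich–Rubinstein modulus -/

/-- **BOUNDARY INSENSITIVITY THROUGH THE KANTOROVICH–RUBINSTEIN DOOR.** Let `d, N ≥ 1`, `β` a 't Hooft coupling,
`OneLinkKRModulus N b K` with `K ≥ 0` on `b ≥ 2(d−1)|β|`; let `W` have continuous terms depending on their own links,
support family `supp` of range `R`, and load witnesses: oscillation `Σ_{X ∋ e} osc X e ≤ a`, self-Lipschitz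
`Σ_{X ∋ e} lip X e ≤ ℓ_s` (`ℓ_s ≥ 0`), cross-Lipschitz `Σ_y Σ_{X ∋ e} lip X y ≤ Λ`. If
`6(d−1)|β| K e^{a}(1 + 2√N ℓ_s) + √N Λ ≤ ρ < 1` then for every DLR state `μ`, every finite link volume `V`, every boundary
field `η` and every Lipschitz cylinder `F` (constant `K_F`, links `Δ` at depth `≥ D` in `V`):
`|∫ F dγ^W_V(· | η) − ∫ F dμ| ≤ 2√N · K_F · #Δ · max(ρ,½)^{⌊D / max(1,R)⌋₊}`. [folklore] -/
theorem abs_boundary_sub_integral_le_of_oneLinkKRModulus (hd : 1 ≤ d) (hN : 1 ≤ N) {β b K a ℓs Λ R ρ : ℝ}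
    (hK : 0 ≤ K) (hℓs : 0 ≤ ℓs) (hb : |β| * (2 * ((d : ℝ) - 1)) ≤ b) (hmod : OneLinkKRModulus N b K)
    {W : Potential (ZdEdge d) (Matrix.specialUnitaryGroup (Fin N) ℂ)} (hWc : ∀ X, Continuous (W X))
    (hWdep : ∀ X, DependsOn (W X) (↑X : Set (ZdEdge d)))
    {supp : Finset (ZdEdge d) → Finset (Finset (ZdEdge d))} (hsupp : W.IsSupportedBy supp)
    {osc : Finset (ZdEdge d) → ZdEdge d → ℝ} (hosc : ∀ X, Dobrushin.IsOscBound (W X) (osc X))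
    (hosca : ∀ e, ∑ X ∈ (supp {e}).filter (fun X => e ∈ X), osc X e ≤ a)
    {lip : Finset (ZdEdge d) → ZdEdge d → ℝ} (hlip : ∀ X, IsLipBound suFrobDist (W X) (lip X))
    (hlips : ∀ e, ∑ X ∈ (supp {e}).filter (fun X => e ∈ X), lip X e ≤ ℓs)
    (hΛ : ∀ e, ∑ y ∈ perturbedNbr supp e, ∑ X ∈ (supp {e}).filter (fun X => e ∈ X), lip X y ≤ Λ)
    (hR : ∀ e, ∀ X ∈ supp {e}, e ∈ X → ∀ y ∈ X, ‖e.1 - y.1‖ ≤ R)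
    (hρ : 6 * ((d : ℝ) - 1) * |β| * (K * exp a * (1 + 2 * Real.sqrt N * ℓs)) + Real.sqrt N * Λ ≤ ρ) (hρ1 : ρ < 1)
    {μ : Measure (LGConfig d (Matrix.specialUnitaryGroup (Fin N) ℂ))}
    (hμ : μ ∈ perturbedGibbsMeasures (d := d) (fundamentalRep (Fin N)) (N * β) W supp)
    (V : Finset (ZdEdge d)) (η : LGConfig d (Matrix.specialUnitaryGroup (Fin N) ℂ))
    {F : LGConfig d (Matrix.specialUnitaryGroup (Fin N) ℂ) → ℝ} {Δ : Finset (ZdEdge d)} {KF : ℝ≥0}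
    (hF : IsLipschitzCylinder (fundamentalRep (Fin N)) F Δ KF) {D : ℝ}
    (hD : ∀ y ∈ Δ, ∀ z, z ∉ V → D ≤ ‖y.1 - z.1‖) :
    |(∫ U, F U ∂(perturbedYM (d := d) (fundamentalRep (Fin N)) (N * β) W supp V η)) - ∫ U, F U ∂μ| ≤
      2 * Real.sqrt N * KF * Δ.card * (max ρ (1 / 2)) ^ ⌊D / max 1 R⌋₊ := by
  have hW : W.IsAdapted := fun X => ⟨hWdep X, (hWc X).measurable⟩
  have hWb : ∀ X, ∃ C, ∀ U, |W X U| ≤ C := fun X => exists_bound_of_continuous (hWc X)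
  exact abs_boundary_sub_integral_le_of_isKRContraction hW hWb hsupp
    (isKRContraction_perturbedYM_of_oneLinkKRModulus hd hN hK hℓs hb hmod hW (supp := supp) hosc hosca hlip hlips)
    (fun x => (sum_perturbedNbr_coeffKR_le (N := N) hd (β := β) (a := a) hK hℓs hΛ x).trans hρ) hρ1 hR hμ V η hF hD

/-! ### `SU(2)`: the quarter door -/

/-- **`SU(2)`, EVERY DIMENSION, QUARTER DOOR** (Wilson units, 't Hooft `β = β_W/4`; modulus `K = 1` on `‖B‖_op ≤ 1`,
radius `2(d−1)|β_W|/4 ≤ 1`): loads `(a, ℓ_s, Λ)` with `(3/2)(d−1)|β_W| e^{a}(1 + 2√2 ℓ_s) + √2 Λ ≤ ρ < 1` ⇒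
`|∫ F dγ^W_V(· | η) − ∫ F dμ| ≤ 2√2 · K_F · #Δ · max(ρ,½)^{⌊D / max(1,R)⌋₊}` for every DLR state, volume, boundary field and
Lipschitz cylinder at depth `D`. [folklore] -/
theorem su2_abs_boundary_sub_integral_le_quarter (hd : 1 ≤ d) {βW a ℓs Λ R ρ : ℝ} (hℓs : 0 ≤ ℓs)
    (hrad : |βW / 4| * (2 * ((d : ℝ) - 1)) ≤ 1)
    {W : Potential (ZdEdge d) (Matrix.specialUnitaryGroup (Fin 2) ℂ)} (hWc : ∀ X, Continuous (W X))
    (hWdep : ∀ X, DependsOn (W X) (↑X : Set (ZdEdge d)))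
    {supp : Finset (ZdEdge d) → Finset (Finset (ZdEdge d))} (hsupp : W.IsSupportedBy supp)
    {osc : Finset (ZdEdge d) → ZdEdge d → ℝ} (hosc : ∀ X, Dobrushin.IsOscBound (W X) (osc X))
    (hosca : ∀ e, ∑ X ∈ (supp {e}).filter (fun X => e ∈ X), osc X e ≤ a)
    {lip : Finset (ZdEdge d) → ZdEdge d → ℝ} (hlip : ∀ X, IsLipBound suFrobDist (W X) (lip X))
    (hlips : ∀ e, ∑ X ∈ (supp {e}).filter (fun X => e ∈ X), lip X e ≤ ℓs)
    (hΛ : ∀ e, ∑ y ∈ perturbedNbr supp e, ∑ X ∈ (supp {e}).filter (fun X => e ∈ X), lip X y ≤ Λ)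
    (hR : ∀ e, ∀ X ∈ supp {e}, e ∈ X → ∀ y ∈ X, ‖e.1 - y.1‖ ≤ R)
    (hρ : 3 / 2 * ((d : ℝ) - 1) * |βW| * (exp a * (1 + 2 * Real.sqrt 2 * ℓs)) + Real.sqrt 2 * Λ ≤ ρ) (hρ1 : ρ < 1)
    {μ : Measure (LGConfig d (Matrix.specialUnitaryGroup (Fin 2) ℂ))}
    (hμ : μ ∈ perturbedGibbsMeasures (d := d) (fundamentalRep (Fin 2)) ((2 : ℕ) * (βW / 4)) W supp)
    (V : Finset (ZdEdge d)) (η : LGConfig d (Matrix.specialUnitaryGroup (Fin 2) ℂ))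
    {F : LGConfig d (Matrix.specialUnitaryGroup (Fin 2) ℂ) → ℝ} {Δ : Finset (ZdEdge d)} {KF : ℝ≥0}
    (hF : IsLipschitzCylinder (fundamentalRep (Fin 2)) F Δ KF) {D : ℝ}
    (hD : ∀ y ∈ Δ, ∀ z, z ∉ V → D ≤ ‖y.1 - z.1‖) :
    |(∫ U, F U ∂(perturbedYM (d := d) (fundamentalRep (Fin 2)) ((2 : ℕ) * (βW / 4)) W supp V η)) - ∫ U, F U ∂μ| ≤
      2 * Real.sqrt 2 * KF * Δ.card * (max ρ (1 / 2)) ^ ⌊D / max 1 R⌋₊ := by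
  have hmod : OneLinkKRModulus 2 (|βW / 4| * (2 * ((d : ℝ) - 1))) 1 :=
    SlabAreaLawDimensions.su2_oneLinkKRModulus_of_le_one hrad
  have hρ' : 6 * ((d : ℝ) - 1) * |βW / 4| * (1 * exp a * (1 + 2 * Real.sqrt ((2 : ℕ) : ℝ) * ℓs)) +
      Real.sqrt ((2 : ℕ) : ℝ) * Λ ≤ ρ := by
    have h4 : |βW / 4| = |βW| / 4 := by rw [abs_div, abs_of_pos (by norm_num : (0 : ℝ) < 4)]
    have h2 : ((2 : ℕ) : ℝ) = 2 := by norm_num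
    rw [h4, h2]
    calc 6 * ((d : ℝ) - 1) * (|βW| / 4) * (1 * exp a * (1 + 2 * Real.sqrt 2 * ℓs)) + Real.sqrt 2 * Λ
        = 3 / 2 * ((d : ℝ) - 1) * |βW| * (exp a * (1 + 2 * Real.sqrt 2 * ℓs)) + Real.sqrt 2 * Λ := by ring
      _ ≤ ρ := hρ
  have h := abs_boundary_sub_integral_le_of_oneLinkKRModulus hd (by norm_num) zero_le_one hℓs le_rfl hmod hWc hWdep hsupp
    hosc hosca hlip hlips hΛ hR hρ' hρ1 hμ V η hF hD
  have e2 : Real.sqrt ((2 : ℕ) : ℝ) = Real.sqrt 2 := by norm_num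
  rw [e2] at h
  exact h

/-- **`SU(2)`, `d = 4`, QUARTER DOOR**: for `|β_W| ≤ 2/3` and loads with `(9/2)|β_W| e^{a}(1 + 2√2 ℓ_s) + √2 Λ ≤ ρ < 1` —
the door behind the column `Qgap` (`(β_W, ε) = (1/8, .130), (1/6, .062), (1/5, .022)`): boundary insensitivity
`≤ 2√2 · K_F · #Δ · max(ρ,½)^{⌊D / max(1,R)⌋₊}`. [folklore] -/
theorem su2_abs_boundary_sub_integral_le_quarter_dim4 {βW a ℓs Λ R ρ : ℝ} (hℓs : 0 ≤ ℓs) (hβ : |βW| ≤ 2 / 3)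
    {W : Potential (ZdEdge 4) (Matrix.specialUnitaryGroup (Fin 2) ℂ)} (hWc : ∀ X, Continuous (W X))
    (hWdep : ∀ X, DependsOn (W X) (↑X : Set (ZdEdge 4)))
    {supp : Finset (ZdEdge 4) → Finset (Finset (ZdEdge 4))} (hsupp : W.IsSupportedBy supp)
    {osc : Finset (ZdEdge 4) → ZdEdge 4 → ℝ} (hosc : ∀ X, Dobrushin.IsOscBound (W X) (osc X))
    (hosca : ∀ e, ∑ X ∈ (supp {e}).filter (fun X => e ∈ X), osc X e ≤ a)
    {lip : Finset (ZdEdge 4) → ZdEdge 4 → ℝ} (hlip : ∀ X, IsLipBound suFrobDist (W X) (lip X))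
    (hlips : ∀ e, ∑ X ∈ (supp {e}).filter (fun X => e ∈ X), lip X e ≤ ℓs)
    (hΛ : ∀ e, ∑ y ∈ perturbedNbr supp e, ∑ X ∈ (supp {e}).filter (fun X => e ∈ X), lip X y ≤ Λ)
    (hR : ∀ e, ∀ X ∈ supp {e}, e ∈ X → ∀ y ∈ X, ‖e.1 - y.1‖ ≤ R)
    (hρ : 9 / 2 * |βW| * (exp a * (1 + 2 * Real.sqrt 2 * ℓs)) + Real.sqrt 2 * Λ ≤ ρ) (hρ1 : ρ < 1)
    {μ : Measure (LGConfig 4 (Matrix.specialUnitaryGroup (Fin 2) ℂ))}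
    (hμ : μ ∈ perturbedGibbsMeasures (d := 4) (fundamentalRep (Fin 2)) ((2 : ℕ) * (βW / 4)) W supp)
    (V : Finset (ZdEdge 4)) (η : LGConfig 4 (Matrix.specialUnitaryGroup (Fin 2) ℂ))
    {F : LGConfig 4 (Matrix.specialUnitaryGroup (Fin 2) ℂ) → ℝ} {Δ : Finset (ZdEdge 4)} {KF : ℝ≥0}
    (hF : IsLipschitzCylinder (fundamentalRep (Fin 2)) F Δ KF) {D : ℝ}
    (hD : ∀ y ∈ Δ, ∀ z, z ∉ V → D ≤ ‖y.1 - z.1‖) :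
    |(∫ U, F U ∂(perturbedYM (d := 4) (fundamentalRep (Fin 2)) ((2 : ℕ) * (βW / 4)) W supp V η)) - ∫ U, F U ∂μ| ≤
      2 * Real.sqrt 2 * KF * Δ.card * (max ρ (1 / 2)) ^ ⌊D / max 1 R⌋₊ := by
  have hrad : |βW / 4| * (2 * (((4 : ℕ) : ℝ) - 1)) ≤ 1 := by
    rw [abs_div, abs_of_pos (by norm_num : (0 : ℝ) < 4)]
    have := abs_nonneg βW
    nlinarith
  refine su2_abs_boundary_sub_integral_le_quarter (d := 4) (by norm_num) hℓs hrad hWc hWdep hsupp hosc hosca hlip hlips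
    hΛ hR ?_ hρ1 hμ V η hF hD
  calc 3 / 2 * (((4 : ℕ) : ℝ) - 1) * |βW| * (exp a * (1 + 2 * Real.sqrt 2 * ℓs)) + Real.sqrt 2 * Λ
      = 9 / 2 * |βW| * (exp a * (1 + 2 * Real.sqrt 2 * ℓs)) + Real.sqrt 2 * Λ := by norm_num
    _ ≤ ρ := hρ

/-! ### The Wilson point through the quarter door: window `β_W < 2/9` on `ℤ⁴` -/

/-- The zero member with the empty support family: zero loads. [folklore] -/
theorem su2_wilson_abs_boundary_sub_integral_le_quarter_dim4 {βW ρ : ℝ} (hρ : 9 / 2 * |βW| ≤ ρ) (hρ1 : ρ < 1)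
    {μ : Measure (LGConfig 4 (Matrix.specialUnitaryGroup (Fin 2) ℂ))}
    (hμ : μ ∈ ymGibbsMeasures (d := 4) (fundamentalRep (Fin 2)) (βW / 2))
    (V : Finset (ZdEdge 4)) (η : LGConfig 4 (Matrix.specialUnitaryGroup (Fin 2) ℂ))
    {F : LGConfig 4 (Matrix.specialUnitaryGroup (Fin 2) ℂ) → ℝ} {Δ : Finset (ZdEdge 4)} {KF : ℝ≥0}
    (hF : IsLipschitzCylinder (fundamentalRep (Fin 2)) F Δ KF) {D : ℝ}
    (hD : ∀ y ∈ Δ, ∀ z, z ∉ V → D ≤ ‖y.1 - z.1‖) :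
    |(∫ U, F U ∂(ymSpecification (d := 4) (fundamentalRep (Fin 2)) (βW / 2) V η)) - ∫ U, F U ∂μ| ≤
      2 * Real.sqrt 2 * KF * Δ.card * (max ρ (1 / 2)) ^ ⌊D⌋₊ := by
  classical
  have hβ : (((2 : ℕ) : ℝ) * (βW / 4) : ℝ) = βW / 2 := by push_cast; ring
  have hβW : |βW| ≤ 2 / 3 := by
    have := abs_nonneg βW
    nlinarith
  set supp : Finset (ZdEdge 4) → Finset (Finset (ZdEdge 4)) := fun _ => ∅ with hsupp
  have hμ' : μ ∈ perturbedGibbsMeasures (d := 4) (fundamentalRep (Fin 2)) ((2 : ℕ) * (βW / 4)) 0 supp := by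
    rwa [perturbedGibbsMeasures_zero, hβ]
  have key := su2_abs_boundary_sub_integral_le_quarter_dim4 (a := 0) (ℓs := 0) (Λ := 0) (R := 0) (ρ := ρ) le_rfl hβW
    (W := 0) (supp := supp) (fun _ => continuous_const) (fun _ _ _ _ => rfl) (fun _ _ _ h => (h rfl).elim)
    (osc := fun _ _ => 0) (fun _ => ⟨fun _ => le_rfl, fun _ _ _ _ => by simp⟩) (fun _ => by simp [hsupp])
    (lip := fun _ _ => 0) (fun _ => ⟨fun _ => le_rfl, fun _ _ _ _ => by simp⟩) (fun _ => by simp [hsupp])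
    (fun _ => by simp [hsupp]) (fun _ _ h => by simp [hsupp] at h) (by
      rw [Real.exp_zero, mul_zero, add_zero, mul_one, mul_one, mul_zero, add_zero]; exact hρ) hρ1 hμ' V η hF hD
  rw [perturbedYM_zero, hβ, max_eq_left (zero_le_one : (0 : ℝ) ≤ 1), div_one] at key
  exact key

/-- **THE WILSON POINT THROUGH THE QUARTER DOOR, `0 ≤ β_W ≤ 1/9`**: every DLR state `μ` of `SU(2)` lattice Yang–Mills on
`ℤ⁴` (tree coupling `β_W/2`) and every finite-volume Wilson distribution with ANY boundary field satisfy
`|∫ F dγ_V(· | η) − ∫ F dμ| ≤ 2√2 · K_F · #Δ · (1/2)^{⌊D⌋₊}` on Lipschitz cylinders at depth `D` (row sum `(9/2)β_W ≤ 1/2`) —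
the pair door's `1/12` (`su2_wilson_boundary_upTo_oneTwelfth`) pushed to `1/9`. [folklore] -/
theorem su2_wilson_boundary_upTo_oneNinth {βW : ℝ} (h0 : 0 ≤ βW) (h : βW ≤ 1 / 9)
    {μ : Measure (LGConfig 4 (Matrix.specialUnitaryGroup (Fin 2) ℂ))}
    (hμ : μ ∈ ymGibbsMeasures (d := 4) (fundamentalRep (Fin 2)) (βW / 2))
    (V : Finset (ZdEdge 4)) (η : LGConfig 4 (Matrix.specialUnitaryGroup (Fin 2) ℂ))
    {F : LGConfig 4 (Matrix.specialUnitaryGroup (Fin 2) ℂ) → ℝ} {Δ : Finset (ZdEdge 4)} {KF : ℝ≥0}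
    (hF : IsLipschitzCylinder (fundamentalRep (Fin 2)) F Δ KF) {D : ℝ}
    (hD : ∀ y ∈ Δ, ∀ z, z ∉ V → D ≤ ‖y.1 - z.1‖) :
    |(∫ U, F U ∂(ymSpecification (d := 4) (fundamentalRep (Fin 2)) (βW / 2) V η)) - ∫ U, F U ∂μ| ≤
      2 * Real.sqrt 2 * KF * Δ.card * (1 / 2 : ℝ) ^ ⌊D⌋₊ := by
  have key := su2_wilson_abs_boundary_sub_integral_le_quarter_dim4 (ρ := 1 / 2)
    (by rw [abs_of_nonneg h0]; linarith) (by norm_num) hμ V η hF hD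
  rwa [max_self] at key

/-- **THE WILSON POINT THROUGH THE QUARTER DOOR, `1/9 ≤ β_W < 2/9`**: `|∫ F dγ_V(· | η) − ∫ F dμ| ≤ 2√2 · K_F · #Δ · ((9/2)β_W)^{⌊D⌋₊}`
— boundary insensitivity of every DLR state of `SU(2)` on `ℤ⁴` throughout the quarter-modulus Wilson window `β_W < 2/9`.
[folklore] -/
theorem su2_wilson_boundary_lt_twoNinths {βW : ℝ} (h0 : 1 / 9 ≤ βW) (h : βW < 2 / 9)
    {μ : Measure (LGConfig 4 (Matrix.specialUnitaryGroup (Fin 2) ℂ))}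
    (hμ : μ ∈ ymGibbsMeasures (d := 4) (fundamentalRep (Fin 2)) (βW / 2))
    (V : Finset (ZdEdge 4)) (η : LGConfig 4 (Matrix.specialUnitaryGroup (Fin 2) ℂ))
    {F : LGConfig 4 (Matrix.specialUnitaryGroup (Fin 2) ℂ) → ℝ} {Δ : Finset (ZdEdge 4)} {KF : ℝ≥0}
    (hF : IsLipschitzCylinder (fundamentalRep (Fin 2)) F Δ KF) {D : ℝ}
    (hD : ∀ y ∈ Δ, ∀ z, z ∉ V → D ≤ ‖y.1 - z.1‖) :
    |(∫ U, F U ∂(ymSpecification (d := 4) (fundamentalRep (Fin 2)) (βW / 2) V η)) - ∫ U, F U ∂μ| ≤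
      2 * Real.sqrt 2 * KF * Δ.card * (9 / 2 * βW) ^ ⌊D⌋₊ := by
  have key := su2_wilson_abs_boundary_sub_integral_le_quarter_dim4 (ρ := 9 / 2 * βW)
    (by rw [abs_of_nonneg (by linarith)]) (by linarith) hμ V η hF hD
  rwa [max_eq_left (by linarith : (1 / 2 : ℝ) ≤ 9 / 2 * βW)] at key

/-- **Boxes, `0 ≤ β_W ≤ 1/9`**: `|∫ F dγ_{boxLinks 4 n}(· | η) − ∫ F dμ| ≤ 2√2 · K_F · #Δ · (1/2)^{n − m}` for Lipschitz cylinders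
based in `[−m, m]⁴`, every DLR state and every boundary field. [folklore] -/
theorem su2_wilson_box_upTo_oneNinth {βW : ℝ} (h0 : 0 ≤ βW) (h : βW ≤ 1 / 9)
    {μ : Measure (LGConfig 4 (Matrix.specialUnitaryGroup (Fin 2) ℂ))}
    (hμ : μ ∈ ymGibbsMeasures (d := 4) (fundamentalRep (Fin 2)) (βW / 2)) {m : ℕ} (n : ℕ)
    (η : LGConfig 4 (Matrix.specialUnitaryGroup (Fin 2) ℂ))
    {F : LGConfig 4 (Matrix.specialUnitaryGroup (Fin 2) ℂ) → ℝ} {Δ : Finset (ZdEdge 4)} {KF : ℝ≥0}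
    (hF : IsLipschitzCylinder (fundamentalRep (Fin 2)) F Δ KF) (hΔ : Δ ⊆ boxLinks 4 m) :
    |(∫ U, F U ∂(ymSpecification (d := 4) (fundamentalRep (Fin 2)) (βW / 2) (boxLinks 4 n) η)) - ∫ U, F U ∂μ| ≤
      2 * Real.sqrt 2 * KF * Δ.card * (1 / 2 : ℝ) ^ (n - m) := by
  have key := su2_wilson_boundary_upTo_oneNinth h0 h hμ (boxLinks 4 n) η hF (D := (n : ℝ) - m)
    fun _ hy _ hz => sub_le_norm_sub_of_mem_boxLinks (hΔ hy) hz
  rwa [natFloor_natCast_sub_natCast] at key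

/-- **Boxes, `1/9 ≤ β_W < 2/9`**: `|∫ F dγ_{boxLinks 4 n}(· | η) − ∫ F dμ| ≤ 2√2 · K_F · #Δ · ((9/2)β_W)^{n − m}`. [folklore] -/
theorem su2_wilson_box_lt_twoNinths {βW : ℝ} (h0 : 1 / 9 ≤ βW) (h : βW < 2 / 9)
    {μ : Measure (LGConfig 4 (Matrix.specialUnitaryGroup (Fin 2) ℂ))}
    (hμ : μ ∈ ymGibbsMeasures (d := 4) (fundamentalRep (Fin 2)) (βW / 2)) {m : ℕ} (n : ℕ)
    (η : LGConfig 4 (Matrix.specialUnitaryGroup (Fin 2) ℂ))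
    {F : LGConfig 4 (Matrix.specialUnitaryGroup (Fin 2) ℂ) → ℝ} {Δ : Finset (ZdEdge 4)} {KF : ℝ≥0}
    (hF : IsLipschitzCylinder (fundamentalRep (Fin 2)) F Δ KF) (hΔ : Δ ⊆ boxLinks 4 m) :
    |(∫ U, F U ∂(ymSpecification (d := 4) (fundamentalRep (Fin 2)) (βW / 2) (boxLinks 4 n) η)) - ∫ U, F U ∂μ| ≤
      2 * Real.sqrt 2 * KF * Δ.card * (9 / 2 * βW) ^ (n - m) := by
  have key := su2_wilson_boundary_lt_twoNinths h0 h hμ (boxLinks 4 n) η hF (D := (n : ℝ) - m)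
    fun _ hy _ hz => sub_le_norm_sub_of_mem_boxLinks (hΔ hy) hz
  rwa [natFloor_natCast_sub_natCast] at key

/-- **TWO-SIDED Wilson point through the quarter door, `|β_W| ≤ 1/9`** (the door reads `|β_W|`): every DLR state of `SU(2)` on `ℤ⁴`
at tree coupling `β_W/2` vs every finite-volume Wilson distribution: `≤ 2√2 · K_F · #Δ · (1/2)^{⌊D⌋₊}`. [folklore] -/
theorem su2_wilson_boundary_abs_le_oneNinth {βW : ℝ} (h : |βW| ≤ 1 / 9)
    {μ : Measure (LGConfig 4 (Matrix.specialUnitaryGroup (Fin 2) ℂ))}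
    (hμ : μ ∈ ymGibbsMeasures (d := 4) (fundamentalRep (Fin 2)) (βW / 2))
    (V : Finset (ZdEdge 4)) (η : LGConfig 4 (Matrix.specialUnitaryGroup (Fin 2) ℂ))
    {F : LGConfig 4 (Matrix.specialUnitaryGroup (Fin 2) ℂ) → ℝ} {Δ : Finset (ZdEdge 4)} {KF : ℝ≥0}
    (hF : IsLipschitzCylinder (fundamentalRep (Fin 2)) F Δ KF) {D : ℝ}
    (hD : ∀ y ∈ Δ, ∀ z, z ∉ V → D ≤ ‖y.1 - z.1‖) :
    |(∫ U, F U ∂(ymSpecification (d := 4) (fundamentalRep (Fin 2)) (βW / 2) V η)) - ∫ U, F U ∂μ| ≤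
      2 * Real.sqrt 2 * KF * Δ.card * (1 / 2 : ℝ) ^ ⌊D⌋₊ := by
  have key := su2_wilson_abs_boundary_sub_integral_le_quarter_dim4 (ρ := 1 / 2) (by linarith) (by norm_num) hμ V η hF hD
  rwa [max_self] at key

/-- **TWO-SIDED, boxes, `|β_W| ≤ 1/9`**: `|∫ F dγ_{boxLinks 4 n}(· | η) − ∫ F dμ| ≤ 2√2 · K_F · #Δ · (1/2)^{n − m}`. [folklore] -/
theorem su2_wilson_box_abs_le_oneNinth {βW : ℝ} (h : |βW| ≤ 1 / 9)
    {μ : Measure (LGConfig 4 (Matrix.specialUnitaryGroup (Fin 2) ℂ))}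
    (hμ : μ ∈ ymGibbsMeasures (d := 4) (fundamentalRep (Fin 2)) (βW / 2)) {m : ℕ} (n : ℕ)
    (η : LGConfig 4 (Matrix.specialUnitaryGroup (Fin 2) ℂ))
    {F : LGConfig 4 (Matrix.specialUnitaryGroup (Fin 2) ℂ) → ℝ} {Δ : Finset (ZdEdge 4)} {KF : ℝ≥0}
    (hF : IsLipschitzCylinder (fundamentalRep (Fin 2)) F Δ KF) (hΔ : Δ ⊆ boxLinks 4 m) :
    |(∫ U, F U ∂(ymSpecification (d := 4) (fundamentalRep (Fin 2)) (βW / 2) (boxLinks 4 n) η)) - ∫ U, F U ∂μ| ≤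
      2 * Real.sqrt 2 * KF * Δ.card * (1 / 2 : ℝ) ^ (n - m) := by
  have key := su2_wilson_boundary_abs_le_oneNinth h hμ (boxLinks 4 n) η hF (D := (n : ℝ) - m)
    fun _ hy _ hz => sub_le_norm_sub_of_mem_boxLinks (hΔ hy) hz
  rwa [natFloor_natCast_sub_natCast] at key

end Summit.Ventures.YMGap.RobustBall

end
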